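import Summits.HubbardSuperconductivity.HubbardSuperconductivity.Theorems.AnisotropyChordTowerSecondOrder
import Summits.HubbardSuperconductivity.HubbardSuperconductivity.Theorems.AnisotropyChordTotalSpinNearFM
import Literature.Probability.LatticeModels.GaussianDomination

/-!
# Route `AnisotropyChord` / H0 rotor rung: the SHAPE of the second-order coefficient — `pOne(n) = cgShape(S, n−S)·‖v‖²/P₄(S)` —
# and its non-degeneracy on the torus (work-order v13(e) of theory seat `hubbard-h0-rotor-theory-1`, memo ROTOR-THEORY-11
# §160 (γ1)/(γ4); director CYCLE-12 ruling (A))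

* `prod_succ_mul_sub_eq` : `∏_{i<n} (i+1)(N−i) = (n!)²·C(N,n)`;
* **`pOne_eq_cgShape`** : `pOne k v = cgShape (|V|/2) ((k+2) − |V|/2) · ‖v‖² / (|V|(|V|−1)(|V|−2)(|V|−3))` (`|V| ≥ 4`; from
  `rV_normSq` and `cg_ratio_identity`) — the `n`-dependence of the leading deficit coefficient is the Clebsch–Gordan shape,
  strictly decreasing in `|M|` (`cgShape_strictAnti`);
* **`solved_twoMagnon_ne_zero`** : on the torus with `L ≥ 2` the solved vector has `‖v‖² > 0` (the pair `{0, (1,1)}` is not an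
  edge while an edge exists, so `u ≠ 0`).
-/

set_option linter.dupNamespace false
set_option autoImplicit false

noncomputable section

open Finset Matrix
open Summit.HubbardSuperconductivity.HubbardSuperconductivity.Theorems.AnisotropyChord.InsertionEntropy
open Literature.MathematicalPhysics.QuantumLattice Literature.Probability.LatticeModels

namespace Summit.HubbardSuperconductivity.HubbardSuperconductivity.Theorems.AnisotropyChord.Tower

/-! ### `∏_{i<n} (i+1)(N−i) = (n!)² C(N,n)` -/

/-- `∏_{i<n} (i+1)(N−i) = (n!)²·C(N,n)` over `ℝ` (`n ≤ N`). [folklore] -/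
theorem prod_succ_mul_sub_eq (N n : ℕ) (h : n ≤ N) :
    (∏ i ∈ Finset.range n, (((i:ℝ) + 1) * ((N:ℝ) - i))) = ((n.factorial : ℝ)) ^ 2 * (N.choose n : ℝ) := by
  rw [Finset.prod_mul_distrib]
  have h1 : (∏ i ∈ Finset.range n, ((i:ℝ) + 1)) = (n.factorial : ℝ) := by
    rw [← Finset.prod_range_add_one_eq_factorial]; push_cast; rfl
  have h2 : (∏ i ∈ Finset.range n, ((N:ℝ) - i)) = (N.descFactorial n : ℝ) := by
    rw [Nat.descFactorial_eq_prod_range]; push_cast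
    refine Finset.prod_congr rfl fun i hi => ?_
    rw [Nat.cast_sub (by have := Finset.mem_range.1 hi; omega)]
  rw [h1, h2, Nat.descFactorial_eq_factorial_mul_choose]; push_cast; ring

variable {V : Type} [Fintype V] [DecidableEq V]

/-- **THE SHAPE OF THE SECOND-ORDER COEFFICIENT**: `pOne k v = cgShape(S, (k+2) − S)·‖v‖²/P₄`, `S = |V|/2`,
`P₄ = |V|(|V|−1)(|V|−2)(|V|−3)` (for `S⁻(ext v) = 0`, `k + 2 ≤ |V|`, `|V| ≥ 4`). [folklore] -/
theorem pOne_eq_cgShape (k : ℕ) (v : Sec V 2 → ℝ) (hlow : lowerSum (secExt 2 v) = fun _ => 0)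
    (hk : k + 2 ≤ Fintype.card V) (hV : 4 ≤ Fintype.card V) :
    pOne k v = cgShape ((Fintype.card V : ℝ) / 2) (((k + 2 : ℕ) : ℝ) - (Fintype.card V : ℝ) / 2) * (v ⬝ᵥ v)
      / ((Fintype.card V : ℝ) * ((Fintype.card V : ℝ) - 1) * ((Fintype.card V : ℝ) - 2) * ((Fintype.card V : ℝ) - 3)) := by
  set Nv : ℝ := (Fintype.card V : ℝ) with hNv
  have hP4 : 0 < Nv * (Nv - 1) * (Nv - 2) * (Nv - 3) := by
    have h4 : (4:ℝ) ≤ Nv := by rw [hNv]; exact_mod_cast hV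
    exact mul_pos (mul_pos (mul_pos (by linarith) (by linarith)) (by linarith)) (by linarith)
  unfold pOne
  rw [rV_normSq k v hlow, card_sec]
  -- the ladder product is the product of `cg_ratio_identity` with `S = Nv/2`
  have hprod : (∏ i ∈ Finset.range k, ladderCoeff (V := V) 2 i)
      = ∏ i ∈ Finset.range k, (((i:ℝ) + 1) * (2 * (Nv / 2) - 4 - i)) := by
    refine Finset.prod_congr rfl fun i _ => ?_
    unfold ladderCoeff; rw [← hNv]; ring
  have hcg := cg_ratio_identity (Nv / 2) k
  rw [← hprod] at hcg
  have h2S : 2 * (Nv / 2) = Nv := by ring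
  rw [h2S] at hcg
  have hbig : (∏ i ∈ Finset.range (k + 2), (((i:ℝ) + 1) * (Nv - i)))
      = (((k + 2).factorial : ℝ)) ^ 2 * ((Fintype.card V).choose (k + 2) : ℝ) := by
    rw [hNv]; exact prod_succ_mul_sub_eq (Fintype.card V) (k + 2) hk
  rw [hbig] at hcg
  have hfac : (((k + 2).factorial : ℝ)) = ((k:ℝ) + 2) * ((k:ℝ) + 1) * (k.factorial : ℝ) := by
    rw [Nat.factorial_succ, Nat.factorial_succ]; push_cast; ring
  rw [hfac] at hcg
  have hkf : (0:ℝ) < k.factorial := by exact_mod_cast Nat.factorial_pos k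
  have hC : (0:ℝ) < ((Fintype.card V).choose (k + 2) : ℝ) := by exact_mod_cast Nat.choose_pos hk
  have hk12 : (0:ℝ) < ((k:ℝ) + 2) * ((k:ℝ) + 1) := by positivity
  -- solve for the ladder product
  have hsolve : (∏ i ∈ Finset.range k, ladderCoeff (V := V) 2 i)
      = (k.factorial : ℝ) ^ 2 * ((Fintype.card V).choose (k + 2) : ℝ)
        * (((k:ℝ) + 2) * ((k:ℝ) + 1) * (Nv - (k + 2)) * (Nv - (k + 2) - 1))
        / (Nv * (Nv - 1) * (Nv - 2) * (Nv - 3)) := by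
    rw [eq_div_iff hP4.ne']
    have e : (((k:ℝ) + 2) * ((k:ℝ) + 1)) ^ 2 * (∏ i ∈ Finset.range k, ladderCoeff (V := V) 2 i)
        * (Nv * (Nv - 1) * (Nv - 2) * (Nv - 3))
        = (((k:ℝ) + 2) * ((k:ℝ) + 1) * (k.factorial : ℝ)) ^ 2 * ((Fintype.card V).choose (k + 2) : ℝ)
          * (((k:ℝ) + 2) * ((k:ℝ) + 1) * (Nv - (k + 2)) * (Nv - (k + 2) - 1)) := by
      rw [← hcg]
    have hne : (((k:ℝ) + 2) * ((k:ℝ) + 1)) ^ 2 ≠ 0 := by positivity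
    refine mul_left_cancel₀ hne ?_
    linear_combination e
  rw [hsolve]
  unfold cgShape
  push_cast
  field_simp
  ring

/-! ### Non-degeneracy on the torus: `v ≠ 0` -/

section Torus

variable {L : ℕ} [NeZero L]

omit [NeZero L] in
/-- The diagonal site `(1,1)` is neither `0` nor a neighbour of `0` on `(ℤ/L)²`, `L ≥ 2`. [folklore] -/
theorem torus_diag_not_adj (hL : 2 ≤ L) :
    (fun _ : Fin 2 => (1 : ZMod L)) ≠ (0 : TorusSite 2 L) ∧
      ¬ (torusGraph 2 L).Adj 0 (fun _ : Fin 2 => (1 : ZMod L)) := by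
  have h1 : (1 : ZMod L) ≠ 0 := by
    intro h
    have h2 : ((1 : ℕ) : ZMod L) = 0 := by exact_mod_cast h
    rw [ZMod.natCast_eq_zero_iff] at h2
    exact absurd (Nat.le_of_dvd one_pos h2) (by omega)
  refine ⟨fun h => h1 (by simpa using congrFun h 0), ?_⟩
  rw [torusGraph_adj_iff]
  rintro ⟨-, ⟨i, hi⟩ | ⟨i, hi⟩⟩
  · -- `(1,1) = 0 + e_i`: evaluate at the other coordinate
    have := congrFun hi (if i = 0 then 1 else 0)
    fin_cases i <;> simp at this <;> exact h1 this
  · -- `0 = (1,1) + e_i`: evaluate at the other coordinate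
    have := congrFun hi (if i = 0 then 1 else 0)
    fin_cases i <;> simp at this <;> exact h1 this.symm

/-- On the torus with `L ≥ 2` the origin has a neighbour, so the constant degree `d` is positive. [folklore] -/
theorem torus_degree_pos (hL : 2 ≤ L) (d : ℕ)
    (hreg : ∀ x : TorusSite 2 L, (∑ y, if (torusGraph 2 L).Adj x y then (1:ℝ) else 0) = d) : 0 < d := by
  have h := hreg 0
  have hadj : (torusGraph 2 L).Adj 0 ((0 : TorusSite 2 L) + Pi.single (0 : Fin 2) 1) :=
    torusGraph_adj_add_single hL 0 0
  have hle : (1:ℝ) ≤ ∑ y, if (torusGraph 2 L).Adj 0 y then (1:ℝ) else 0 := by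
    have := Finset.single_le_sum (f := fun y => if (torusGraph 2 L).Adj 0 y then (1:ℝ) else 0)
      (fun y _ => by positivity) (Finset.mem_univ ((0 : TorusSite 2 L) + Pi.single (0 : Fin 2) 1))
    rw [if_pos hadj] at this
    exact this
  rw [h] at hle
  exact_mod_cast (show (0:ℝ) < d by linarith)

/-- **`v ≠ 0`**: on the torus with `L ≥ 2`, the solved two-magnon vector has `‖v‖² > 0` — the right-hand side
`u = [x ∼ y] − κ` does not vanish on the non-edge `{0, (1,1)}` (`κ = d/(|V|−1) > 0`). [folklore] -/
theorem solved_twoMagnon_ne_zero (hL : 2 ≤ L) (d : ℕ) (κ : ℝ)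
    (hreg : ∀ x : TorusSite 2 L, (∑ y, if (torusGraph 2 L).Adj x y then (1:ℝ) else 0) = d)
    (hκ : κ * ((Fintype.card (TorusSite 2 L) : ℝ) - 1) = d)
    (v : Sec (TorusSite 2 L) 2 → ℝ) (hAv : secOp (torusGraph 2 L) 2 v = secRes 2 (edgeMinusMean (torusGraph 2 L) κ)) :
    0 < v ⬝ᵥ v := by
  have hd := torus_degree_pos hL d hreg
  have hκ0 : κ ≠ 0 := by
    intro h; rw [h, zero_mul] at hκ
    exact absurd (by exact_mod_cast hκ.symm : d = 0) hd.ne'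
  obtain ⟨hne0, hnadj⟩ := torus_diag_not_adj hL
  -- the non-edge pair as a two-particle configuration
  set e : TorusSite 2 L := fun _ => (1 : ZMod L) with he
  set T : Finset (TorusSite 2 L) := {0, e} with hT
  have hTcard : T.card = 2 := by rw [hT, Finset.card_pair (Ne.symm hne0)]
  have hzs : (zeroSet (cfgOf T)).card = 2 := by rw [zeroSet_cfgOf, hTcard]
  set s₀ : Sec (TorusSite 2 L) 2 := ⟨cfgOf T, hzs⟩ with hs₀
  -- `u(s₀) = −κ ≠ 0`
  have hins : insideOrd (torusGraph 2 L) (cfgOf T) = 0 := by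
    unfold insideOrd
    refine Finset.sum_eq_zero fun x _ => Finset.sum_eq_zero fun y _ => ?_
    rw [if_neg]
    rintro ⟨hadj, hx, hy⟩
    have hx' : x ∈ T := by unfold cfgOf at hx; by_contra h; simp [h] at hx
    have hy' : y ∈ T := by unfold cfgOf at hy; by_contra h; simp [h] at hy
    rw [hT, Finset.mem_insert, Finset.mem_singleton] at hx' hy'
    rcases hx' with rfl | rfl <;> rcases hy' with rfl | rfl
    · exact hadj.ne rfl
    · exact hnadj hadj
    · exact hnadj hadj.symm
    · exact hadj.ne rfl
  have hu : secRes 2 (edgeMinusMean (torusGraph 2 L) κ) s₀ = -κ := by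
    unfold secRes edgeMinusMean
    rw [if_pos (by rw [zerosCard_eq_card, hzs]; norm_num), hins]; ring
  -- if `v = 0` then `A v = 0`, contradicting `u(s₀) ≠ 0`
  by_contra hle
  have hvv : v ⬝ᵥ v = 0 := le_antisymm (not_lt.1 hle)
    (by unfold dotProduct; exact Finset.sum_nonneg fun i _ => mul_self_nonneg _)
  have hv0 : v = 0 := by
    funext s
    have := (Finset.sum_eq_zero_iff_of_nonneg fun i _ => mul_self_nonneg (v i)).1 hvv s (Finset.mem_univ s)
    exact mul_self_eq_zero.1 this
  have := congrFun hAv s₀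
  rw [hv0, map_zero, hu] at this
  exact hκ0 (by simpa using this.symm)

end Torus

end Summit.HubbardSuperconductivity.HubbardSuperconductivity.Theorems.AnisotropyChord.Tower
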